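import Literature.MathematicalPhysics.QuantumLattice.OverlapLocality

/-!
# Crux `TiltedFlatness` (K3 of route `PauliWegnerSea`), negative side — the massless Wilson kernel

Support file of the standing disprover of item stmt-QuantumFields-14070 (and of its predecessor
stmt-QuantumFields-11511, whose work file `Cruxes/TiltedFlatness/Disproof.lean` recorded the
statement as the near-miss `KerWilsonDiracMassless`).

**Theorem (kernel of the massless `r = 1` Wilson–Dirac operator).**  For every unitary
representation `ρ`, every periodic lattice `(ℤ/L)⁴` and every gauge field `U`,
`D_W(U; m = 0, r = 1) ψ = 0` iff `ψ` is covariantly constant,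
`ψ(x,a,α) = Σ_b ρ(U(x,μ))_{ab} ψ(x+μ̂,b,α)` for all `x, μ, a, α`
(`wilsonDirac_massless_mulVec_eq_zero_iff'`); hence `det D_W(U;0,1) = 0` iff `U` admits a
non-zero parallel colour field (`det_wilsonDirac_massless_eq_zero_iff`).

Proof: `D_W = 4·1 − Σ_μ W_μ` with four isometries `W_μ` (tree: `wilsonDirac_eq_sub_sum_wilsonHop`,
`conjTranspose_mul_wilsonHop`); `Σ_μ ‖ψ − W_μψ‖² = 8‖ψ‖² − 2 Re⟨ψ, Σ_μ W_μ ψ⟩ = 0` forces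
`W_μ ψ = ψ` for each `μ` (`mulVec_eq_self_of_sum_isometries`), and projecting with `1 ⊗ P∓_μ`
shows `W_μ ψ = ψ ⇔ (F_μ ⊗ 1)ψ = ψ` (`wilsonHop_mulVec_eq_self_iff`; the covariant shift
`F_μ ⊗ 1_spin` is written inline as a `reindex`ed Kronecker product, no new definition).

Used by the disprover to certify the STRUCTURAL zeros of the fermionic weight
`F = |det D_W(·; m = 0)|` on pure-gauge fibres (the witness showing that clause (a) of the crux
needs its `(1+β)^p` loss); of independent use to the provers of `FibreCofactorDomination`
(where `det ≡ 0` two-star fibres are the named risk).  Standard material. [folklore]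
-/

namespace Summit.QuantumFields.QCD.Theorems.TiltedFlatnessNegative

open Matrix
open scoped Kronecker
open Literature.MathematicalPhysics.QuantumFieldTheory Literature.MathematicalPhysics.QuantumLattice
  Literature.Probability.LatticeModels

section Abstract


variable {n : Type*} [Fintype n]

/-- `v† v = Σ_i ‖v_i‖²` for a complex vector. [folklore] -/
theorem star_dotProduct_self_eq (v : n → ℂ) :
    star v ⬝ᵥ v = ((∑ i, ‖v i‖ ^ 2 : ℝ) : ℂ) := by
  simp [dotProduct, Complex.conj_mul', Complex.ofReal_sum]

/-- `v† v = 0` forces `v = 0`. [folklore] -/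
theorem eq_zero_of_star_dotProduct_self (v : n → ℂ) (h : star v ⬝ᵥ v = 0) : v = 0 := by
  rw [star_dotProduct_self_eq] at h
  have h' : ∑ i, ‖v i‖ ^ 2 = 0 := by exact_mod_cast h
  funext i
  have := (Finset.sum_eq_zero_iff_of_nonneg fun j _ => sq_nonneg ‖v j‖).mp h' i (Finset.mem_univ i)
  exact norm_eq_zero.mp ((pow_eq_zero_iff two_ne_zero).mp this)

variable [DecidableEq n]

/-- An isometry preserves `v† v`. [folklore] -/
theorem star_mulVec_dotProduct_mulVec {W : Matrix n n ℂ} (hW : Wᴴ * W = 1) (v : n → ℂ) :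
    star (W *ᵥ v) ⬝ᵥ (W *ᵥ v) = star v ⬝ᵥ v := by
  rw [star_mulVec, dotProduct_mulVec, vecMul_vecMul, hW, vecMul_one]

/-- **Equality in the triangle inequality for isometries.** If finitely many isometries `W_μ`
(`W_μᴴ W_μ = 1`) satisfy `Σ_μ W_μ v = (#μ) · v`, then every `W_μ` fixes `v`:
`Σ_μ ‖v − W_μ v‖² = 2(#μ)‖v‖² − 2 Re⟨v, Σ_μ W_μ v⟩ = 0`. [folklore] -/
theorem mulVec_eq_self_of_sum_isometries {ι : Type*} [Fintype ι] (W : ι → Matrix n n ℂ)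
    (hW : ∀ μ, (W μ)ᴴ * W μ = 1) (v : n → ℂ)
    (hv : ∑ μ, W μ *ᵥ v = (Fintype.card ι : ℂ) • v) (μ : ι) : W μ *ᵥ v = v := by
  set q : ℂ := star v ⬝ᵥ v with hq
  have hq_real : star q = q := by
    rw [hq, star_dotProduct_self_eq]; exact Complex.conj_ofReal _
  have hexp : ∀ ν, star (v - W ν *ᵥ v) ⬝ᵥ (v - W ν *ᵥ v) =
      2 * q - star v ⬝ᵥ (W ν *ᵥ v) - star (star v ⬝ᵥ (W ν *ᵥ v)) := by
    intro ν
    have hiso := star_mulVec_dotProduct_mulVec (hW ν) v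
    have hcross : star (W ν *ᵥ v) ⬝ᵥ v = star (star v ⬝ᵥ (W ν *ᵥ v)) := by
      rw [← star_dotProduct_star, star_star]
    rw [star_sub, sub_dotProduct, dotProduct_sub, dotProduct_sub, hiso, hcross]
    ring
  have hsumc : ∑ ν, star v ⬝ᵥ (W ν *ᵥ v) = (Fintype.card ι : ℂ) * q := by
    rw [← dotProduct_sum, hv, dotProduct_smul, smul_eq_mul]
  have hsum : ∑ ν, star (v - W ν *ᵥ v) ⬝ᵥ (v - W ν *ᵥ v) = 0 := by
    simp_rw [hexp]
    rw [Finset.sum_sub_distrib, Finset.sum_sub_distrib, ← star_sum, hsumc, Finset.sum_const,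
      Finset.card_univ, nsmul_eq_mul, star_mul', hq_real]
    simp only [star_natCast]
    ring
  -- each summand is a sum of squares, hence zero
  have hnonneg : ∀ ν, 0 ≤ ∑ i, ‖(v - W ν *ᵥ v) i‖ ^ 2 := fun ν =>
    Finset.sum_nonneg fun i _ => sq_nonneg _
  have hreal : ∑ ν, ∑ i, ‖(v - W ν *ᵥ v) i‖ ^ 2 = 0 := by
    have : ((∑ ν, ∑ i, ‖(v - W ν *ᵥ v) i‖ ^ 2 : ℝ) : ℂ) = 0 := by
      rw [← hsum, Complex.ofReal_sum]
      exact Finset.sum_congr rfl fun ν _ => (star_dotProduct_self_eq _).symm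
    exact_mod_cast this
  have hμ := (Finset.sum_eq_zero_iff_of_nonneg fun ν _ => hnonneg ν).mp hreal μ (Finset.mem_univ μ)
  have hzero : v - W μ *ᵥ v = 0 := by
    refine eq_zero_of_star_dotProduct_self _ ?_
    rw [star_dotProduct_self_eq, hμ, Complex.ofReal_zero]
  exact (sub_eq_zero.mp hzero).symm

end Abstract

section Wilson

variable {L N : ℕ} {G : Type*} [Group G] (ρ : G →* Matrix (Fin N) (Fin N) ℂ)

omit [Group G] in
/-- `reindex` is multiplicative along an equivalence. [folklore] -/
private theorem reindex_mul_reindex {m o : Type*} [Fintype m] [Fintype o] (e : m ≃ o)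
    (A B : Matrix m m ℂ) : reindex e e A * reindex e e B = reindex e e (A * B) := by
  simp only [reindex_apply, submatrix_mul_equiv]

omit [Group G] in
/-- `reindex` is additive. [folklore] -/
private theorem reindex_add' {m o : Type*} (e : m ≃ o) (A B : Matrix m m ℂ) :
    reindex e e A + reindex e e B = reindex e e (A + B) := by
  simp only [reindex_apply, submatrix_add, Pi.add_apply]

variable [NeZero L]

/-- Entry formula for the covariant shift. [folklore] -/
theorem covShift_mulVec_apply (U : GaugeConfig 4 L G) (μ : Fin 4)
    (ψ : TorusSite 4 L × Fin N × Fin 4 → ℂ) (x : TorusSite 4 L) (a : Fin N) (α : Fin 4) :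
    (Matrix.reindex (Equiv.prodAssoc (TorusSite 4 L) (Fin N) (Fin 4))
      (Equiv.prodAssoc (TorusSite 4 L) (Fin N) (Fin 4)) (linkHop ρ U μ ⊗ₖ (1 : Matrix (Fin 4) (Fin 4) ℂ)) *ᵥ ψ)
      (x, a, α) = ∑ b, ρ (U (x, μ)) a b * ψ (Site.shift x μ, b, α) := by
  simp only [mulVec, dotProduct, reindex_apply, submatrix_apply, Equiv.prodAssoc_symm_apply,
    kroneckerMap_apply, linkHop, of_apply, one_apply, Fintype.sum_prod_type]
  simp only [ite_mul, zero_mul, mul_ite, mul_one, mul_zero, Finset.sum_ite_eq, Finset.mem_univ,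
    if_true]
  rw [Finset.sum_comm]
  simp only [Finset.sum_ite_eq', Finset.mem_univ, if_true]

/-- `W_μ ψ = ψ` iff `T_μ ψ = ψ`: project the fixed-point equation with `1 ⊗ P∓_μ` and use
`F_μ F_μᴴ = F_μᴴ F_μ = 1`, `P⁻ + P⁺ = 1`. [folklore] -/
theorem wilsonHop_mulVec_eq_self_iff (hρ : ∀ g, ρ g ∈ Matrix.unitaryGroup (Fin N) ℂ)
    (U : GaugeConfig 4 L G) (μ : Fin 4) (ψ : TorusSite 4 L × Fin N × Fin 4 → ℂ) :
    wilsonHop ρ U μ *ᵥ ψ = ψ ↔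
      Matrix.reindex (Equiv.prodAssoc (TorusSite 4 L) (Fin N) (Fin 4))
      (Equiv.prodAssoc (TorusSite 4 L) (Fin N) (Fin 4)) (linkHop ρ U μ ⊗ₖ (1 : Matrix (Fin 4) (Fin 4) ℂ)) *ᵥ ψ = ψ := by
  set e := Equiv.prodAssoc (TorusSite 4 L) (Fin N) (Fin 4) with he
  set F := linkHop ρ U μ with hF
  set Pm := chiralProjMinus μ with hPm
  set Pp := chiralProjPlus μ with hPp
  have hW : wilsonHop ρ U μ = reindex e e (F ⊗ₖ Pm + Fᴴ ⊗ₖ Pp) := rfl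
  have hFF : F * Fᴴ = 1 := linkHop_mul_conjTranspose ρ hρ U μ
  have hFF' : Fᴴ * F = 1 := conjTranspose_mul_linkHop ρ hρ U μ
  have M1 : reindex e e ((1 : Matrix (TorusSite 4 L × Fin N) _ ℂ) ⊗ₖ Pm) * wilsonHop ρ U μ =
      reindex e e (F ⊗ₖ Pm) := by
    rw [hW, reindex_mul_reindex, mul_add, ← mul_kronecker_mul, ← mul_kronecker_mul, one_mul, one_mul,
      hPm, hPp, chiralProjMinus_mul_self, chiralProjMinus_mul_chiralProjPlus, kronecker_zero, add_zero]
  have M2 : reindex e e (F ⊗ₖ Pp) * wilsonHop ρ U μ =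
      reindex e e ((1 : Matrix (TorusSite 4 L × Fin N) _ ℂ) ⊗ₖ Pp) := by
    rw [hW, reindex_mul_reindex, mul_add, ← mul_kronecker_mul, ← mul_kronecker_mul, hFF, hPm, hPp,
      chiralProjPlus_mul_chiralProjMinus, chiralProjPlus_mul_self, kronecker_zero, zero_add]
  have M3 : reindex e e (F ⊗ₖ Pm) + reindex e e (F ⊗ₖ Pp) =
      reindex e e (F ⊗ₖ (1 : Matrix (Fin 4) (Fin 4) ℂ)) := by
    rw [reindex_add', ← kronecker_add, hPm, hPp, chiralProjMinus_add_chiralProjPlus]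
  have M4 : reindex e e ((1 : Matrix (TorusSite 4 L × Fin N) _ ℂ) ⊗ₖ Pm) +
      reindex e e ((1 : Matrix (TorusSite 4 L × Fin N) _ ℂ) ⊗ₖ Pp) = 1 := by
    rw [reindex_add', ← kronecker_add, hPm, hPp, chiralProjMinus_add_chiralProjPlus, one_kronecker_one,
      reindex_apply, submatrix_one_equiv]
  have M5 : wilsonHop ρ U μ = reindex e e ((1 : Matrix (TorusSite 4 L × Fin N) _ ℂ) ⊗ₖ Pm) *
      reindex e e (F ⊗ₖ (1 : Matrix (Fin 4) (Fin 4) ℂ)) +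
      reindex e e ((1 : Matrix (TorusSite 4 L × Fin N) _ ℂ) ⊗ₖ Pp) *
      reindex e e (Fᴴ ⊗ₖ (1 : Matrix (Fin 4) (Fin 4) ℂ)) := by
    rw [reindex_mul_reindex, reindex_mul_reindex, ← mul_kronecker_mul, ← mul_kronecker_mul,
      one_mul, one_mul, mul_one, mul_one, reindex_add', hW]
  have M6 : reindex e e (Fᴴ ⊗ₖ (1 : Matrix (Fin 4) (Fin 4) ℂ)) *
      reindex e e (F ⊗ₖ (1 : Matrix (Fin 4) (Fin 4) ℂ)) = 1 := by
    rw [reindex_mul_reindex, ← mul_kronecker_mul, hFF', one_mul, one_kronecker_one, reindex_apply,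
      submatrix_one_equiv]
  constructor
  · intro h
    have h1 : reindex e e (F ⊗ₖ Pm) *ᵥ ψ =
        reindex e e ((1 : Matrix (TorusSite 4 L × Fin N) _ ℂ) ⊗ₖ Pm) *ᵥ ψ := by
      calc reindex e e (F ⊗ₖ Pm) *ᵥ ψ
          = (reindex e e ((1 : Matrix (TorusSite 4 L × Fin N) _ ℂ) ⊗ₖ Pm) * wilsonHop ρ U μ) *ᵥ ψ := by
            rw [M1]
        _ = reindex e e ((1 : Matrix (TorusSite 4 L × Fin N) _ ℂ) ⊗ₖ Pm) *ᵥ ψ := by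
            rw [← mulVec_mulVec, h]
    have h2 : reindex e e (F ⊗ₖ Pp) *ᵥ ψ =
        reindex e e ((1 : Matrix (TorusSite 4 L × Fin N) _ ℂ) ⊗ₖ Pp) *ᵥ ψ := by
      calc reindex e e (F ⊗ₖ Pp) *ᵥ ψ
          = (reindex e e (F ⊗ₖ Pp) * wilsonHop ρ U μ) *ᵥ ψ := by rw [← mulVec_mulVec, h]
        _ = reindex e e ((1 : Matrix (TorusSite 4 L × Fin N) _ ℂ) ⊗ₖ Pp) *ᵥ ψ := by rw [M2]
    calc reindex e e (F ⊗ₖ (1 : Matrix (Fin 4) (Fin 4) ℂ)) *ᵥ ψ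
        = (reindex e e (F ⊗ₖ Pm) + reindex e e (F ⊗ₖ Pp)) *ᵥ ψ := by rw [M3]
      _ = reindex e e ((1 : Matrix (TorusSite 4 L × Fin N) _ ℂ) ⊗ₖ Pm) *ᵥ ψ +
            reindex e e ((1 : Matrix (TorusSite 4 L × Fin N) _ ℂ) ⊗ₖ Pp) *ᵥ ψ := by
          rw [add_mulVec, h1, h2]
      _ = ψ := by rw [← add_mulVec, M4, one_mulVec]
  · intro h
    have h3 : reindex e e (Fᴴ ⊗ₖ (1 : Matrix (Fin 4) (Fin 4) ℂ)) *ᵥ ψ = ψ := by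
      calc reindex e e (Fᴴ ⊗ₖ (1 : Matrix (Fin 4) (Fin 4) ℂ)) *ᵥ ψ
          = reindex e e (Fᴴ ⊗ₖ (1 : Matrix (Fin 4) (Fin 4) ℂ)) *ᵥ
              (reindex e e (F ⊗ₖ (1 : Matrix (Fin 4) (Fin 4) ℂ)) *ᵥ ψ) := by rw [h]
        _ = ψ := by rw [mulVec_mulVec, M6, one_mulVec]
    calc wilsonHop ρ U μ *ᵥ ψ
        = reindex e e ((1 : Matrix (TorusSite 4 L × Fin N) _ ℂ) ⊗ₖ Pm) *ᵥ
            (reindex e e (F ⊗ₖ (1 : Matrix (Fin 4) (Fin 4) ℂ)) *ᵥ ψ) +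
          reindex e e ((1 : Matrix (TorusSite 4 L × Fin N) _ ℂ) ⊗ₖ Pp) *ᵥ
            (reindex e e (Fᴴ ⊗ₖ (1 : Matrix (Fin 4) (Fin 4) ℂ)) *ᵥ ψ) := by
          rw [M5, add_mulVec, ← mulVec_mulVec, ← mulVec_mulVec]
      _ = ψ := by rw [h, h3, ← add_mulVec, M4, one_mulVec]


/-- **Kernel of the massless Wilson–Dirac operator (matrix form).**  For unitary `ρ`,
`D_W(U; 0, 1) ψ = 0` iff every covariant shift fixes `ψ`. [folklore] -/
theorem wilsonDirac_massless_mulVec_eq_zero_iff (hρ : ∀ g, ρ g ∈ Matrix.unitaryGroup (Fin N) ℂ)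
    (U : GaugeConfig 4 L G) (ψ : TorusSite 4 L × Fin N × Fin 4 → ℂ) :
    wilsonDirac ρ U 0 1 *ᵥ ψ = 0 ↔ ∀ μ,
      Matrix.reindex (Equiv.prodAssoc (TorusSite 4 L) (Fin N) (Fin 4))
      (Equiv.prodAssoc (TorusSite 4 L) (Fin N) (Fin 4)) (linkHop ρ U μ ⊗ₖ (1 : Matrix (Fin 4) (Fin 4) ℂ)) *ᵥ ψ = ψ := by
  have hD : wilsonDirac ρ U 0 1 *ᵥ ψ = (4 : ℂ) • ψ - ∑ μ, wilsonHop ρ U μ *ᵥ ψ := by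
    rw [wilsonDirac_eq_sub_sum_wilsonHop ρ hρ U 0, sub_mulVec, smul_mulVec, one_mulVec,
      Matrix.sum_mulVec]
    norm_num
  rw [hD, sub_eq_zero]
  constructor
  · intro h μ
    rw [← wilsonHop_mulVec_eq_self_iff ρ hρ]
    refine mulVec_eq_self_of_sum_isometries (fun ν => wilsonHop ρ U ν)
      (fun ν => conjTranspose_mul_wilsonHop ρ hρ U ν) ψ ?_ μ
    rw [← h]
    simp
  · intro h
    have hW : ∀ μ, wilsonHop ρ U μ *ᵥ ψ = ψ := fun μ =>
      (wilsonHop_mulVec_eq_self_iff ρ hρ U μ ψ).mpr (h μ)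
    simp only [hW, Finset.sum_const, Finset.card_univ, Fintype.card_fin]
    rw [← Nat.cast_smul_eq_nsmul ℂ]
    norm_num

/-- **Kernel of the massless Wilson–Dirac operator (pointwise form).**  For unitary `ρ`,
`D_W(U; m = 0, r = 1) ψ = 0` iff `ψ(x,a,α) = Σ_b ρ(U(x,μ))_{ab} ψ(x+μ̂,b,α)` for all
`x, μ, a, α` — `ψ` is a parallel (covariantly constant) colour field, spin component by spin
component. [folklore] -/
theorem wilsonDirac_massless_mulVec_eq_zero_iff' (hρ : ∀ g, ρ g ∈ Matrix.unitaryGroup (Fin N) ℂ)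
    (U : GaugeConfig 4 L G) (ψ : TorusSite 4 L × Fin N × Fin 4 → ℂ) :
    wilsonDirac ρ U 0 1 *ᵥ ψ = 0 ↔
      ∀ (x : TorusSite 4 L) (μ : Fin 4) (a : Fin N) (α : Fin 4),
        ∑ b, ρ (U (x, μ)) a b * ψ (Site.shift x μ, b, α) = ψ (x, a, α) := by
  rw [wilsonDirac_massless_mulVec_eq_zero_iff ρ hρ U ψ]
  constructor
  · intro h x μ a α
    have := congrFun (h μ) (x, a, α)
    rwa [covShift_mulVec_apply] at this
  · intro h μ
    funext p
    obtain ⟨x, a, α⟩ := p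
    rw [covShift_mulVec_apply]
    exact h x μ a α

/-- **The massless Wilson determinant vanishes iff the gauge field has a parallel colour field.**
[folklore] -/
theorem det_wilsonDirac_massless_eq_zero_iff (hρ : ∀ g, ρ g ∈ Matrix.unitaryGroup (Fin N) ℂ)
    (U : GaugeConfig 4 L G) :
    (wilsonDirac ρ U 0 1).det = 0 ↔ ∃ ψ : TorusSite 4 L × Fin N × Fin 4 → ℂ, ψ ≠ 0 ∧
      ∀ (x : TorusSite 4 L) (μ : Fin 4) (a : Fin N) (α : Fin 4),
        ∑ b, ρ (U (x, μ)) a b * ψ (Site.shift x μ, b, α) = ψ (x, a, α) := by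
  rw [← Matrix.exists_mulVec_eq_zero_iff]
  simp only [ne_eq, wilsonDirac_massless_mulVec_eq_zero_iff' ρ hρ U]

end Wilson

end Summit.QuantumFields.QCD.Theorems.TiltedFlatnessNegative
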